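import Summits.ResolutionOfSingularities.ResolutionOfSingularities.Theses.RuledResidues
import Summits.ResolutionOfSingularities.ResolutionOfSingularities.Theorems.RuledResiduesRegularModelRuledReach
import Summits.ResolutionOfSingularities.ResolutionOfSingularities.Theorems.RuledResiduesRegularModelRuledExceptional
import Literature.AlgebraicGeometry.Resolution.DivisorialPlace
import HarnessLib

/-!
# `RuledResidues.RegularModelRuled` (stmt-ResolutionOfSingularities-18077), part 3/3 — PROVED (Abhyankar's ruledness)

Route `ResolutionOfSingularities/RuledResidues`, crux `RegularModelRuled` (rank 4), by the line
`dvr-descent` (`Cruxes/RegularModelRuled/Lines/dvr_descent.lean`). The crux: a divisorial place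
`W` of `K/k` (a DVR, essentially of finite type over `k`) dominating a REGULAR local ring `A_P`
of dimension `≥ 2` of an affine model `A` (`Frac A = K`) has ruled residue field `κ(W) = L(t)`.

Proof: run the sequence of quadratic transforms `R₀ = A_P → R₁ → ⋯` of `R₀` ALONG `W` inside `K`.
Because `W` is discrete of rank one and `W = B_𝔭` is essentially of finite type, the sequence
REACHES `W` (`dvrReach`, part 1); its members stay regular; the last member `S = R_n ≠ W` is regular
of dimension `c + 1 ≥ 2` with transform `W` (`penultimate`, part 1); then
`κ(W) ≅ Frac κ(S)[X₁, …, X_c]` (`exceptionalResidue`, part 2), which is ruled: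
`L = κ(S)(X₁..X_{c-1})`, `t = X_c` (`ratFuncRuled`, here, by `MvPolynomial.finSuccEquiv` and
`IsLocalization.integerNormalization`). No transcendence-degree bookkeeping ("prime divisor of
`A_P`", dimension formula over an imperfect `k`) is needed.

References: Abhyankar 1956, *On the valuations centered in a local domain*, Prop. 3–4;
Zariski–Samuel II, App. 5; Ishii–Kollár arXiv:math/0207171 Ex. 2.5.
-/

-- single-problem summit: the doubled namespace component `ResolutionOfSingularities` is forced
set_option linter.dupNamespace false

namespace Summit.ResolutionOfSingularities.ResolutionOfSingularities.Theorems.RuledResiduesRegularModelRuled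

open IsLocalRing Literature.AlgebraicGeometry.Resolution IsDiscreteValuationRing

noncomputable section

/-! ## Rational function fields in `c ≥ 1` variables are ruled (field plumbing) -/

/-- **A rational function field in `c ≥ 1` variables is ruled** (was `stub_ratFuncRuled`,
PROVED): if `E` is the field of fractions of `F[X₀, …, X_n]` through an injective `ι`, then
`E = L(t)` with `L = Frac F[X₁, …, X_n] ⊆ E` and `t = ι X₀` transcendental over `L`
(`MvPolynomial.finSuccEquiv`; transcendence by clearing denominators with
`IsLocalization.integerNormalization`). -/
theorem ratFuncRuled (F E : Type) [Field F] [Field E] (c : ℕ) (hc : 1 ≤ c)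
    (ι : MvPolynomial (Fin c) F →+* E) (hι : Function.Injective ι)
    (hfrac : ∀ z : E, ∃ p q : MvPolynomial (Fin c) F, ι q ≠ 0 ∧ z * ι q = ι p) :
    ∃ (L : Subfield E) (t : E),
      (∀ a : F, ι (MvPolynomial.C a) ∈ L) ∧
      (∀ f : Polynomial L, f ≠ 0 → Polynomial.eval₂ L.subtype t f ≠ 0) ∧
      (∀ x : E, ∃ f g : Polynomial L, Polynomial.eval₂ L.subtype t g ≠ 0 ∧
        x * Polynomial.eval₂ L.subtype t g = Polynomial.eval₂ L.subtype t f) := by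
  classical
  obtain ⟨n, rfl⟩ : ∃ n, c = n + 1 := ⟨c - 1, by omega⟩
  -- `F[X₀, …, X_n] ≅ P[Y]` with `P = F[X₁, …, X_n]`; `κ : P → F[X₀, …, X_n]`
  let φ := MvPolynomial.finSuccEquiv F n
  let κ : MvPolynomial (Fin n) F →+* MvPolynomial (Fin (n + 1)) F :=
    (φ.symm : Polynomial (MvPolynomial (Fin n) F) →+* MvPolynomial (Fin (n + 1)) F).comp
      Polynomial.C
  let ιP : MvPolynomial (Fin n) F →+* E := ι.comp κ
  let t : E := ι (MvPolynomial.X 0)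
  -- `ι ∘ φ⁻¹ = eval₂ ιP t`
  have hkey : ∀ p : Polynomial (MvPolynomial (Fin n) F),
      ι (φ.symm p) = Polynomial.eval₂ ιP t p := by
    intro p
    have h : ι.comp (φ.symm : Polynomial (MvPolynomial (Fin n) F) →+* MvPolynomial (Fin (n + 1)) F) =
        Polynomial.eval₂RingHom ιP t := by
      refine Polynomial.ringHom_ext (fun b => ?_) ?_
      · change ι (φ.symm (Polynomial.C b)) = Polynomial.eval₂ ιP t (Polynomial.C b)
        rw [Polynomial.eval₂_C]
        rfl
      · change ι (φ.symm Polynomial.X) = Polynomial.eval₂ ιP t Polynomial.X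
        rw [Polynomial.eval₂_X]
        have hX : φ.symm Polynomial.X = MvPolynomial.X 0 := by
          rw [AlgEquiv.symm_apply_eq]
          exact MvPolynomial.finSuccEquiv_X_zero.symm
        rw [hX]
    exact RingHom.congr_fun h p
  have hιP : Function.Injective ιP :=
    hι.comp (φ.symm.injective.comp Polynomial.C_injective)
  have hκC : ∀ a : F, κ (MvPolynomial.C a) = MvPolynomial.C a := fun a =>
    RingHom.congr_fun (MvPolynomial.finSuccEquiv_comp_C_eq_C (R := F) n) a
  -- `L = Frac ιP(P) ⊆ E`
  let L : Subfield E := Subfield.closure (Set.range ιP)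
  have hιPL : ∀ y, ιP y ∈ L := fun y => Subfield.subset_closure ⟨y, rfl⟩
  let ιL : MvPolynomial (Fin n) F →+* L := ιP.codRestrict L hιPL
  have hιL : L.subtype.comp ιL = ιP := RingHom.ext fun _ => rfl
  letI : Algebra (MvPolynomial (Fin n) F) L := ιL.toAlgebra
  haveI : FaithfulSMul (MvPolynomial (Fin n) F) L :=
    (faithfulSMul_iff_algebraMap_injective _ _).mpr fun a b h =>
      hιP (congrArg Subtype.val h)
  haveI : IsFractionRing (MvPolynomial (Fin n) F) L := by
    refine IsFractionRing.of_field (R := MvPolynomial (Fin n) F) (K := L) fun z => ?_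
    have hsub : Subring.closure (Set.range ιP) ≤ ιP.range :=
      Subring.closure_le.mpr (by rintro _ ⟨a, rfl⟩; exact ⟨a, rfl⟩)
    obtain ⟨y, hy, w, hw, hyw⟩ := Subfield.mem_closure_iff.mp z.2
    obtain ⟨a, rfl⟩ := hsub hy
    obtain ⟨b, rfl⟩ := hsub hw
    refine ⟨a, b, Subtype.ext ?_⟩
    exact hyw.symm
  refine ⟨L, t, fun a => ?_, fun f hf hft => ?_, fun z => ?_⟩
  · -- constants lie in `L`
    have ha : ι (MvPolynomial.C a) = ιP (MvPolynomial.C a) := by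
      change _ = ι (κ (MvPolynomial.C a))
      rw [hκC]
    rw [ha]
    exact hιPL _
  · -- `t` is transcendental over `L`: clear denominators
    set g := IsLocalization.integerNormalization (nonZeroDivisors (MvPolynomial (Fin n) F)) f
      with hg
    have hg0 : g ≠ 0 := fun h => hf (IsFractionRing.integerNormalization_eq_zero_iff.mp h)
    have hgt : Polynomial.eval₂ ιP t g = 0 := by
      have h := IsLocalization.integerNormalization_eval₂_eq_zero
        (nonZeroDivisors (MvPolynomial (Fin n) F)) L.subtype f hft
      rwa [show L.subtype.comp (algebraMap (MvPolynomial (Fin n) F) L) = ιP from hιL] at h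
    apply hg0
    apply φ.symm.injective
    rw [map_zero]
    apply hι
    rw [map_zero, hkey, hgt]
  · -- `E = L(t)`
    obtain ⟨p, q, hq, hzq⟩ := hfrac z
    refine ⟨(φ p).map ιL, (φ q).map ιL, ?_, ?_⟩
    · rw [Polynomial.eval₂_map, hιL, ← hkey, AlgEquiv.symm_apply_apply]
      exact hq
    · rw [Polynomial.eval₂_map, Polynomial.eval₂_map, hιL, ← hkey, ← hkey,
        AlgEquiv.symm_apply_apply, AlgEquiv.symm_apply_apply]
      exact hzq

/-! ## The composition -/

/-- **THE CRUX** `RuledResidues.RegularModelRuled` (Abhyankar's ruledness), PROVED: from `dvrReach`,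
`penultimate` (part 1), `exceptionalResidue` (part 2), `ratFuncRuled` and the sequence glue. -/
theorem regularModelRuled_proof :
    Summit.ResolutionOfSingularities.ResolutionOfSingularities.Theses.RuledResidues.RegularModelRuled := by
  intro k K _ _ _ W hk hdvr hdiv A hAfg hAfr h hregP hdimP
  classical
  -- the starting ring `R₀ = A_P ⊆ K`
  set R₀ : Subring K := locAtCentre A.toSubring W with hR₀
  have hAR₀ : A.toSubring ≤ R₀ := le_locAtCentre _ W
  haveI hreg₀ : IsRegularLocalRing R₀ := (isRegularLocalRing_locAtCentre_iff h).mpr hregP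
  have hdim₀ : (2 : WithBot ℕ∞) ≤ ringKrullDim R₀ := by
    rw [← ringKrullDim_eq_of_ringEquiv (locAtCentreEquiv h).toRingEquiv]
    exact hdimP
  have hof₀ : IsLocalRingOf R₀ := by
    refine ⟨isLocalRing_locAtCentre h, fun z => ?_⟩
    obtain ⟨a, b, hb, rfl⟩ := IsFractionRing.div_surjective (A := A) z
    refine ⟨a, hAR₀ a.2, b, hAR₀ b.2, ?_, rfl⟩
    have hb0 : b ≠ 0 := nonZeroDivisors.ne_zero hb
    exact fun h0 => hb0 (Subtype.ext h0)
  have hnf₀ : ¬ IsField R₀ := by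
    intro hF
    have h0 := ringKrullDim_eq_zero_of_isField hF
    rw [h0] at hdim₀
    exact absurd hdim₀ (by decide)
  have hdom₀ : SubringDominates R₀ W.toSubring := subringDominates_locAtCentre h
  -- the sequence of quadratic transforms of `R₀` along `W`
  set R : ℕ → Subring K := quadraticSeq W R₀ with hRdef
  have hR0 : R 0 = R₀ := rfl
  have hstep : ∀ i, IsQuadraticTransformAlong W (R i) (R (i + 1)) :=
    isQuadraticTransformAlong_quadraticSeq_of_isRegularLocalRing hreg₀ hnf₀ hdom₀
  -- it reaches `W`: the divisorial model `B` is finitely generated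
  haveI := hdvr
  obtain ⟨B, hBfg, hBW, hloc⟩ := hdiv
  obtain ⟨S, hSB⟩ := hBfg
  have hkR₀ : Set.range (algebraMap k K) ⊆ (R₀ : Set K) := by
    rintro _ ⟨c, rfl⟩
    exact hAR₀ (algebraMap k A c).2
  have hBN : B.toSubring ≤ Subring.closure ((R₀ : Set K) ∪ ↑S) := by
    rw [← hSB, Algebra.adjoin_eq_ring_closure]
    exact Subring.closure_mono (Set.union_subset_union_left _ hkR₀)
  have hSBset : (S : Set K) ⊆ B := by
    rw [← hSB]
    exact Algebra.subset_adjoin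
  have hNO : Subring.closure ((R₀ : Set K) ∪ ↑S) ≤ W.toSubring :=
    Subring.closure_le.mpr (Set.union_subset hdom₀.1 (hSBset.trans hBW))
  have hON : W.toSubring ≤ locAtCentre (Subring.closure ((R₀ : Set K) ∪ ↑S)) W := by
    intro x hx
    obtain ⟨b, s, hb, hs, hsW, hxs⟩ := hloc x hx
    have hvs : W.valuation s = 1 := valuation_eq_one_of_notMem_nonunits W (hBW hs) hsW
    refine ⟨b, hBN hb, s, hBN hs, hvs, ?_⟩
    rw [← hxs, mul_div_cancel_right₀ _ (ne_zero_of_notMem_nonunits W hsW)]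
  obtain ⟨c, hc⟩ := dvrReach W R hof₀ hdom₀ hstep hNO S
    (fun z hz => Subring.subset_closure (Or.inr hz)) le_rfl hON
  -- the penultimate ring `R_n`: regular of dimension `≥ 2`, with `R_{n+1} = W`
  obtain ⟨n, hregn, hdimn, hn⟩ := penultimate W R hreg₀ hdim₀ hof₀ hdom₀ hstep ⟨c, hc⟩
  have hS : IsQuadraticTransformAlong W (R n) W.toSubring := hn ▸ hstep n
  -- the residue field of `W` is `Frac κ(R_n)[X₁, …, X_c]`, `c ≥ 1`, hence ruled
  have hdomn : SubringDominates (R n) W.toSubring := (sequence_dominates hdom₀ hstep n).1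
  obtain ⟨d, hd, ι, hinj, hfrac, hcomp⟩ := exceptionalResidue W (R n) hregn hdimn hdomn hS
  obtain ⟨L, t, hL, htr, hgen⟩ :=
    ratFuncRuled (ResidueField (R n)) (ResidueField W) d hd ι hinj hfrac
  refine ⟨L, t, fun a => ?_, htr, hgen⟩
  -- `k ⊆ A ⊆ R₀ ⊆ R_n`, and the residue of a constant is a constant
  have hmono : Monotone R := sequence_monotone hstep
  have haRn : algebraMap k K a ∈ R n := hmono (Nat.zero_le n) (hAR₀ (algebraMap k A a).2)
  have key := hcomp ⟨algebraMap k K a, haRn⟩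
  have hmem := hL (residue (R n) ⟨algebraMap k K a, haRn⟩)
  rw [key] at hmem
  convert hmem using 2

end

end Summit.ResolutionOfSingularities.ResolutionOfSingularities.Theorems.RuledResiduesRegularModelRuled
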